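import Summits.ABC.IUTFork.Cor312LicenceShallowMultiSlotLicence
import Summits.ABC.IUTFork.Cor312LicenceTameExactRealising
import Summits.ABC.IUTFork.Cor312SlotLicenceMovers
import HarnessLib

/-!
# [IUTchIII] Cor. 3.12 at the sharp real settings — the SLOT licence (reading (P)) in the TAME MULTI-SLOT regime: the whole mover chain
# of abc-iut-w5-d236 / abc-iut-w4-d006 (multi-slot movers ⇒ targets ⇒ tame slots ⇒ tame ORDERS) lives in (Ind2), hence proves
# `Cor312.Setting.SlotLicence`; with abc-iut-w5-d009's tame iff this DECIDES the γ line's S-side clause at uniformly tame realising data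

PROOF-ONLY record file (D-0012; 0 definitions, 0 `Prop` facts) of the abc-iut cell (branch C certificate seat abc-iut-C-cert-2 gen 3; sequel of
`Cor312SlotLicenceMovers.lean`, p460145 — the γ line's non-vacuity). TAKES NO SIDE on [IUTchIII] Cor. 3.12 or on any author.

Every theorem below is the VERBATIM twin of a landed (U)-licence theorem with `thetaHull ↦ thetaSlotHull` / `Licence ↦ SlotLicence` — the
proofs are unchanged except that the moved box point is booked in `⋃₀ thetaSlotImages` (its moving family is an (Ind2)-FAMILY,
`LogShells.exists_mem_Ind2Family_apply_eq`; no capsule permutation, no strip automorphism is ever used):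
* `qRegion_subset_thetaSlotHull_settingDHVolSharp_inl` / `_of_slotMovers` / `_of_targets` / `_of_tame_slots` / `_of_forall_not_mem` ←
  abc-iut-w5-d236 `Cor312LicenceShallowMultiSlot` (p? — `…thetaHull…` twins);
* `qRegion_subset_thetaSlotHull_settingDHVolSharp_of_tame_orders`, `slotLicence_settingDHVolSharp_of_tame_orders`,
  `slotLicence_settingPrVolSharp_of_tame_orders` ← abc-iut-w4-d006 / w5-d236 `Cor312LicenceShallowMultiSlotLicence`;
* (sequel `Cor312SlotLicenceTameIff.lean`) **`slotLicence_settingPrVolSharp_iff_of_realises_tame`** — at Θ- and q-ideles REALISING the pilot divisors with integral q-degrees `P_w ≥ 1` and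
  uniformly tame bad fibres (`e_p ≤ p − 2`): `SlotLicence ⟺ ∀ bad w | p, ∀ j = i+1: e_p·((j²P_w − 1) div e_p) + 1 − j(e_p − 1) ≤ P_w` — the SAME
  integer predicate as abc-iut-w5-d009's `licence_settingPrVolSharp_iff_of_realises_tame` (p448597): (⟹) through `licence_of_slotLicence` and
  w5-d009's (⟹); (⟸) through the slot-licence tame-orders chain. So at uniformly tame realising data the (U)-licence and the SLOT licence are
  EQUIVALENT and decided by ONE integer predicate: every WINDOW-TABLE U1 verdict is a verdict for the γ line's S-side clause too.

HONEST SCOPE: statements about OUR typed sharp containers and Dupuy–Hilado's typed (Ind2); the slot licence is a STRONGER-THAN-PRINT reading of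
Step (xi-f); nothing here asserts or refutes [IUTchIII] Cor. 3.12 or bears on the printed global inequality. [cite: DupuyHilado2025, §3.3, §3.4,
§3.9, §4.9, §4.11–4.12] [cite: NeukirchANT1999, Ch. II Prop. (5.5), (6.8)] [cite: WeilBNT1967, Ch. II §2, Th. 1] [claim: Mochizuki2012, status: disputed]
for every IUT sentence quoted. typed ≠ proved; instantiated ≠ endorsed.
-/

noncomputable section

open Set Function
open scoped Pointwise

namespace Summit.ABC.IUTFork.Thm311.Real

open Cor312 Cor312.Setting Cor312Vol Cor312Vol.ExplicitDepth Literature.IUT.LogThetaLattice Literature.IUT.LogVolume NumberField IsDedekindDomain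
open Literature.NumberTheory.NumberFields Literature.NumberTheory.GaloisRepresentations.Ultrametric

variable {F : Type} [Field F] [NumberField F] (X : PilotData F) {logv : PadicLogs F} (hlog : LogvAnalytic logv)
  (M : Type) [Field M] [NumberField M]
  (archPk : ∀ (j : (thetaIndex X).Label) (vQ : (thetaIndex X).VQ), Set ((logShellsDH X logv).Packet j vQ))
  (archSub : ∀ (j : (thetaIndex X).Label) (v : (thetaIndex X).V),
    Set ((logShellsDH X logv).Packet j ((thetaIndex X).over v)))
  (Ψ : ℤ → ∀ v : (thetaIndex X).V, v ∈ (thetaIndex X).Vbad → Set ((logShellsDH X logv).StarPacket v))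
  (act : ℤ → ∀ v : (thetaIndex X).V, v ∈ (thetaIndex X).Vbad →
    (logShellsDH X logv).StarPacket v → Module.End ℚ ((logShellsDH X logv).StarPacket v))
  (Mmod : ℤ → ∀ j : (thetaIndex X).LabelStar, Set ((logShellsDH X logv).GlobalPacket j.1))
  (region : ℤ → ∀ j : (thetaIndex X).LabelStar, FinDivisor M → ∀ vQ : (thetaIndex X).VQ,
    Set ((logShellsDH X logv).Packet j.1 vQ))
  (n : ℤ) {HT : Type} {LogLink : HT → HT → Type} {IsFull : ∀ {s t : HT}, LogLink s t → Prop}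
  (lat : LGPGaussianLogThetaLattice LogLink IsFull)
  {Frd : Type} {IsoF : Frd → Frd → Type} {Ob : Frd → Type} {realify : Frd → Frd} {Strip : Type}
  {IsoS : Strip → Strip → Type} {Mv : ∀ v : (thetaIndex X).V, v ∈ (thetaIndex X).Vbad → Type}
  [∀ v h, Monoid (Mv v h)]
  (sig : GlobalLGPFrobenioidSignature (thetaIndex X).lstar (thetaIndex X).V (· ∈ (thetaIndex X).Vbad)
    Frd IsoF Ob realify Strip IsoS Mv)
  (split : SplittingMonoids Mv) {ObΔ : Type} {N : ∀ v : (thetaIndex X).V, v ∈ (thetaIndex X).Vbad → Type}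
  [∀ v h, Monoid (N v h)] (qData : QPilotData ObΔ N)
  (tq : ∀ (pp : Nat.Primes) (x : (thetaIndex X).Fibre (.inr pp)), haveI : Fact (pp : ℕ).Prime := ⟨pp.2⟩; kOf X pp.1 x)
  (t : ∀ (pp : Nat.Primes) (_ : Fin X.lstar) (x : (thetaIndex X).Fibre (.inr pp)),
    haveI : Fact (pp : ℕ).Prime := ⟨pp.2⟩; kOf X pp.1 x)
  (htq0 : ∀ pp x, tq pp x ≠ 0)
  (htq1 : ∀ (pp : Nat.Primes) (x : (thetaIndex X).Fibre (.inr pp)),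
    haveI : Fact (pp : ℕ).Prime := ⟨pp.2⟩; placeOf X pp.1 x ∉ X.S → ‖tq pp x‖ = 1)
  (col : ℤ → Column (logShellsDH X logv))

/-- At an archimedean `v_ℚ` the q-region lies in the SLOT hull unconditionally (no field factor there) — twin of abc-iut-w5-d236's
`qRegion_subset_thetaHull_settingDHVolSharp_inl`. [folklore] -/
theorem qRegion_subset_thetaSlotHull_settingDHVolSharp_inl (j : (thetaIndex X).Label) (u : Unit) :
    (settingDHVolSharp X hlog M archPk archSub Ψ act Mmod region n lat sig split qData tq t htq0 htq1).qRegion j (.inl u) ⊆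
      (settingDHVolSharp X hlog M archPk archSub Ψ act Mmod region n lat sig split qData tq t htq0 htq1).thetaSlotHull j (.inl u) := by
  set P := settingDHVolSharp X hlog M archPk archSub Ψ act Mmod region n lat sig split qData tq t htq0 htq1 with hP
  show factorMapDH X hlog j (.inl u) ⁻¹' hullSet (factorFieldDH X hlog j (.inl u)) (qCentreDH X hlog tq j (.inl u)) ⊆
    (HullFrame.ofComparison (factorFieldDH X hlog j (.inl u)) (factorMapDH X hlog j (.inl u))).hull (⋃₀ P.thetaSlotImages j (.inl u))
  exact HullFrame.preimage_hullSet_subset_hull_ofComparison (factorFieldDH X hlog j (.inl u)) (factorMapDH X hlog j (.inl u)) _ _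
    fun s => s.elim

/-- **q-REGION ⊆ SLOT HULL AT `(j, p)` FROM MOVERS ON ALL `j+1` SLOTS** — VERBATIM twin of abc-iut-w5-d236's
`qRegion_subset_thetaHull_settingDHVolSharp_of_slotMovers`: the moving family is an (Ind2)-FAMILY (`LogShells.exists_mem_Ind2Family_apply_eq`), so the moved
box point lies in `⋃₀ thetaSlotImages`. [claim: Mochizuki2012, status: disputed] [cite: DupuyHilado2025, §3.9, §4.9, §4.11] -/
theorem qRegion_subset_thetaSlotHull_settingDHVolSharp_of_slotMovers (j : (thetaIndex X).Label) (pp : Nat.Primes)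
    (hmov : haveI : Fact (pp : ℕ).Prime := ⟨pp.2⟩
      ∃ g : (thetaIndex X).Caps j → ∀ x : (thetaIndex X).Fibre (.inr pp),
          (logShellsDH X logv).carrier x.1 ≃ₗ[ℚ] (logShellsDH X logv).carrier x.1,
        (∀ a x, g a x ∈ ismDH logv x.1) ∧
        ∀ e : (thetaIndex X).Caps j → (thetaIndex X).Fibre (.inr pp),
          ‖tq pp (e (Fin.last _))‖ ≤
            ∏ a, ‖(presAt X hlog pp).φ (e a) (g a (e a) (((presAt X hlog pp).φ (e a)).symm
              (Pi.mulSingle (M := fun _ : (thetaIndex X).Caps j => (presAt X hlog pp).k (e a)) (Fin.last _)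
                (labelIdele X t pp j (e a)) a)))‖) :
    (settingDHVolSharp X hlog M archPk archSub Ψ act Mmod region n lat sig split qData tq t htq0 htq1).qRegion j (.inr pp) ⊆
      (settingDHVolSharp X hlog M archPk archSub Ψ act Mmod region n lat sig split qData tq t htq0 htq1).thetaSlotHull j (.inr pp) := by
  haveI : Fact (pp : ℕ).Prime := ⟨pp.2⟩
  set P := settingDHVolSharp X hlog M archPk archSub Ψ act Mmod region n lat sig split qData tq t htq0 htq1 with hP
  show factorMapDH X hlog j (.inr pp) ⁻¹' hullSet (factorFieldDH X hlog j (.inr pp)) (qCentreDH X hlog tq j (.inr pp)) ⊆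
    (HullFrame.ofComparison (factorFieldDH X hlog j (.inr pp)) (factorMapDH X hlog j (.inr pp))).hull (⋃₀ P.thetaSlotImages j (.inr pp))
  refine HullFrame.preimage_hullSet_subset_hull_ofComparison (factorFieldDH X hlog j (.inr pp))
    (factorMapDH X hlog j (.inr pp)) _ _ ?_
  · set L := logShellsDH X logv with hL
    set Pr := presAt X hlog pp with hPr
    -- the movers, one per (slot, place)
    obtain ⟨G, hG, hGn⟩ := hmov
    obtain ⟨Φ, hΦ, hΦj⟩ := L.exists_mem_Ind2Family_apply_eq
      (show L.factorwise j (.inr pp) (fun a => L.summandwise (.inr pp) (G a)) ∈ L.Ind2 j (.inr pp) from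
        ⟨G, fun a x => hG a x, rfl⟩)
    -- the point `x₀ = 1 ⊗ ⋯ ⊗ 1 ⊗ t_{Θ,j,v_j}` of the Θ-box at every summand
    let y : (thetaIndex X).Caps j → L.Packet1 (.inr pp) := fun a x =>
      (Pr.φ x).symm (Pi.mulSingle (M := fun _ : (thetaIndex X).Caps j => Pr.k x) (Fin.last _) (labelIdele X t pp j x) a)
    let x₀ : L.Packet j (.inr pp) := PiTensorProduct.tprod ℚ y
    have hcmp : ∀ e : (thetaIndex X).Caps j → (thetaIndex X).Fibre (.inr pp),
        Pr.comparison j x₀ e = iota pp.1 (Pr.kk e) (Fin.last _) (labelIdele X t pp j (e (Fin.last _))) := by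
      intro e
      rw [Pr.comparison_tprod, iota_eq_purePacket]
      refine congrArg (PiTensorProduct.tprod ℚ_[pp]) (funext fun a => ?_)
      rcases eq_or_ne a (Fin.last _) with rfl | ha
      · simp [y]
      · simp [y, Pi.mulSingle_eq_of_ne ha]
    have hx₀ : x₀ ∈ P.thetaRegion3 j (.inr pp) := by
      rw [hP, settingDHVolSharp, thetaRegion3_thetaBoxDH]
      show (fun z => Pr.factorMap j z) x₀ ∈ Pr.boxOf (sharpBoxDH X hlog t pp j)
      intro e
      refine ⟨Pr.comparison j x₀ e, ?_, fun i => rfl⟩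
      rw [hcmp e]
      exact ⟨1, Subring.one_mem _, mul_one _⟩
    -- the moved point: a pure tensor with slot components `g_{a,v_a}(slot value)`
    have hu : Φ j (.inr pp) x₀ ∈ ⋃₀ P.thetaSlotImages j (.inr pp) :=
      Set.mem_sUnion.2 ⟨_, ⟨Φ, hΦ, rfl⟩, Set.mem_image_of_mem _ hx₀⟩
    have hcmp' : ∀ e : (thetaIndex X).Caps j → (thetaIndex X).Fibre (.inr pp),
        Pr.comparison j (Φ j (.inr pp) x₀) e =
          purePacket pp.1 (Pr.kk e) fun a => Pr.φ (e a) (G a (e a) (y a (e a))) := by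
      intro e
      let y' : (thetaIndex X).Caps j → L.Packet1 (.inr pp) := fun a x => G a x (y a x)
      have hΦx : Φ j (.inr pp) x₀ = PiTensorProduct.tprod ℚ y' := by
        rw [hΦj]
        exact PiTensorProduct.congr_tprod (fun a => L.summandwise (.inr pp) (G a)) y
      rw [hΦx, Pr.comparison_tprod]
      rfl
    rintro ⟨e, i⟩
    refine ⟨Φ j (.inr pp) x₀, hu, ?_⟩
    show ‖dEquiv pp.1 (Pr.kk e) (iota pp.1 (Pr.kk e) (Fin.last _) (tq pp (e (Fin.last _)))) i‖ ≤
      ‖dEquiv pp.1 (Pr.kk e) (Pr.comparison j (Φ j (.inr pp) x₀) e) i‖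
    rw [hcmp' e, norm_dEquiv_iota, NonIsometryMover.norm_dEquiv_purePacket]
    exact hGn e

/-- **q-region ⊆ SLOT hull at `(j, p)` from TWO TARGET FUNCTIONS** (the non-last slots donate `R`, the last slot reaches `N`) — twin of
abc-iut-w5-d236's `…thetaHull…_of_targets`. [claim: Mochizuki2012, status: disputed] [cite: DupuyHilado2025, §3.9, §4.9] -/
theorem qRegion_subset_thetaSlotHull_settingDHVolSharp_of_targets (j : (thetaIndex X).Label) (pp : Nat.Primes)
    (R Nn : (thetaIndex X).Fibre (.inr pp) → ℝ) (hR0 : ∀ x, 0 ≤ R x) (hN0 : ∀ x, 0 ≤ Nn x)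
    (hR : haveI : Fact (pp : ℕ).Prime := ⟨pp.2⟩
      ∀ x : (thetaIndex X).Fibre (.inr pp), ∃ g ∈ ismDH logv x.1,
        R x ≤ ‖(presAt X hlog pp).φ x (g (((presAt X hlog pp).φ x).symm 1))‖)
    (hN : haveI : Fact (pp : ℕ).Prime := ⟨pp.2⟩
      ∀ x : (thetaIndex X).Fibre (.inr pp), ∃ g ∈ ismDH logv x.1,
        Nn x ≤ ‖(presAt X hlog pp).φ x (g (((presAt X hlog pp).φ x).symm (labelIdele X t pp j x)))‖)
    (hle : haveI : Fact (pp : ℕ).Prime := ⟨pp.2⟩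
      ∀ e : (thetaIndex X).Caps j → (thetaIndex X).Fibre (.inr pp),
        ‖tq pp (e (Fin.last _))‖ ≤ (∏ a : Fin (j : ℕ), R (e a.castSucc)) * Nn (e (Fin.last _))) :
    (settingDHVolSharp X hlog M archPk archSub Ψ act Mmod region n lat sig split qData tq t htq0 htq1).qRegion j (.inr pp) ⊆
      (settingDHVolSharp X hlog M archPk archSub Ψ act Mmod region n lat sig split qData tq t htq0 htq1).thetaSlotHull j (.inr pp) := by
  haveI : Fact (pp : ℕ).Prime := ⟨pp.2⟩
  choose g₁ hg₁ hg₁n using hR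
  choose g₂ hg₂ hg₂n using hN
  refine qRegion_subset_thetaSlotHull_settingDHVolSharp_of_slotMovers X hlog M archPk archSub Ψ act Mmod region n lat sig split qData
    tq t htq0 htq1 j pp ⟨fun a x => if a = Fin.last _ then g₂ x else g₁ x, fun a x => ?_, fun e => ?_⟩
  · by_cases ha : a = Fin.last _
    · simp only [ha, if_true]; exact hg₂ x
    · simp only [if_neg ha]; exact hg₁ x
  · refine (hle e).trans ?_
    rw [Fin.prod_univ_castSucc]
    refine mul_le_mul (Finset.prod_le_prod (fun a _ => hR0 _) fun a _ => ?_) ?_ (hN0 _)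
      (Finset.prod_nonneg fun a _ => norm_nonneg _)
    · have hne : (a.castSucc : (thetaIndex X).Caps j) ≠ Fin.last _ := Fin.castSucc_ne_last a
      dsimp only
      rw [if_neg hne, Pi.mulSingle_eq_of_ne hne]
      exact hg₁n (e a.castSucc)
    · dsimp only
      rw [if_pos rfl, Pi.mulSingle_eq_same]
      exact hg₂n (e (Fin.last _))

/-- **q-region ⊆ SLOT hull in the TAME MULTI-SLOT regime** (`p > 2`, `e_x ≤ p − 2`, uniformizers, the `p`-level window) — twin of abc-iut-w5-d236's
`…thetaHull…_of_tame_slots`. [claim: Mochizuki2012, status: disputed] [cite: DupuyHilado2025, §4.9] [cite: WeilBNT1967, Ch. II §2, Th. 1] -/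
theorem qRegion_subset_thetaSlotHull_settingDHVolSharp_of_tame_slots (i : Fin (thetaIndex X).lstar) (pp : Nat.Primes) (ρ : ℝ)
    (hρ1 : 1 ≤ ρ)
    (hρ : haveI : Fact (pp : ℕ).Prime := ⟨pp.2⟩
      ∀ x : (thetaIndex X).Fibre (.inr pp),
        2 < (pp : ℕ) ∧ (placeOf X pp.1 x).asIdeal.ramificationIdx ℤ ≤ (pp : ℕ) - 2 ∧
          ∃ ϖ : (kOf X pp.1 x)ˣ, IsUniformizer ϖ ∧ ρ ≤ ‖(pp : ℚ_[pp])‖⁻¹ * ‖(ϖ : kOf X pp.1 x)‖)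
    (hwin : haveI : Fact (pp : ℕ).Prime := ⟨pp.2⟩
      ∀ w : (thetaIndex X).Fibre (.inr pp),
        ‖tq pp w‖ ≤ ‖t pp i w‖ ∨
          ∃ (ϖ : (kOf X pp.1 w)ˣ) (k : ℤ), IsUniformizer ϖ ∧
            ‖(pp : ℚ_[pp])‖ * (‖(pp : ℚ_[pp])‖ ^ k * ‖(ϖ : kOf X pp.1 w)‖) < ‖t pp i w‖ ∧
            ‖t pp i w‖ ≤ ‖(pp : ℚ_[pp])‖ ^ k * ‖(ϖ : kOf X pp.1 w)‖ ∧
            ‖tq pp w‖ ≤ ρ ^ ((i : ℕ) + 1) * (‖(pp : ℚ_[pp])‖ ^ k * ‖(ϖ : kOf X pp.1 w)‖)) :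
    (settingDHVolSharp X hlog M archPk archSub Ψ act Mmod region n lat sig split qData tq t htq0 htq1).qRegion
        (labelSucc i) (.inr pp) ⊆
      (settingDHVolSharp X hlog M archPk archSub Ψ act Mmod region n lat sig split qData tq t htq0 htq1).thetaSlotHull
        (labelSucc i) (.inr pp) := by
  haveI : Fact (pp : ℕ).Prime := ⟨pp.2⟩
  have hρ0 : 0 ≤ ρ := zero_le_one.trans hρ1
  -- per place: a last-slot target `N_w ≥ 0`, reached by a mover, with `‖t_{q,w}‖ ≤ ρ^{i+1}·N_w`
  have key : ∀ w : (thetaIndex X).Fibre (.inr pp), ∃ Nw : ℝ, 0 ≤ Nw ∧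
      (∃ g ∈ ismDH logv w.1,
        Nw ≤ ‖(presAt X hlog pp).φ w (g (((presAt X hlog pp).φ w).symm (labelIdele X t pp (labelSucc i) w)))‖) ∧
      ‖tq pp w‖ ≤ ρ ^ ((i : ℕ) + 1) * Nw := by
    intro w
    rcases hwin w with h | ⟨ϖ, k, hϖ, h1, h2, h3⟩
    · refine ⟨‖t pp i w‖, norm_nonneg _, ⟨LinearEquiv.refl ℚ _, refl_mem_ismDH logv w.1, ?_⟩, ?_⟩
      · rw [labelIdele_labelSucc]
        simp only [LinearEquiv.refl_apply, LinearEquiv.apply_symm_apply]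
        exact le_of_eq rfl
      · exact h.trans (le_mul_of_one_le_left (norm_nonneg _) (one_le_pow₀ hρ1))
    · obtain ⟨hp2, he, -⟩ := hρ w
      refine ⟨‖(pp : ℚ_[pp])‖ ^ k * ‖(ϖ : kOf X pp.1 w)‖,
        mul_nonneg (zpow_nonneg (norm_nonneg _) _) (norm_nonneg _), ?_, h3⟩
      exact exists_mem_ismDH_norm_labelIdele_ge_of_tame X hlog t pp (labelSucc i) w hp2 k
        ⟨he, ϖ, hϖ, by rw [labelIdele_labelSucc]; exact h1, by rw [labelIdele_labelSucc]; exact h2, rfl⟩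
  choose Nf hN0 hN hle using key
  refine qRegion_subset_thetaSlotHull_settingDHVolSharp_of_targets X hlog M archPk archSub Ψ act Mmod region n lat sig split qData
    tq t htq0 htq1 (labelSucc i) pp (fun _ => ρ) Nf (fun _ => hρ0) hN0 (fun x => ?_) hN fun e => ?_
  · obtain ⟨hp2, he, ϖ, hϖ, hρle⟩ := hρ x
    exact exists_mem_ismDH_norm_one_ge_of_tame X hlog pp x hp2 ⟨he, ϖ, hϖ, hρle⟩
  · rw [Fin.prod_const]
    exact hle _

/-- At a prime with NO bad place over it the q-region lies in the SLOT hull (both ideles are units there) — twin of abc-iut-w5-d236's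
`…thetaHull…_of_forall_not_mem`. [folklore] -/
theorem qRegion_subset_thetaSlotHull_settingDHVolSharp_of_forall_not_mem (i : Fin (thetaIndex X).lstar) (pp : Nat.Primes)
    (ht1 : ∀ (pp : Nat.Primes) (i : Fin X.lstar) (x : (thetaIndex X).Fibre (.inr pp)),
      haveI : Fact (pp : ℕ).Prime := ⟨pp.2⟩; placeOf X pp.1 x ∉ X.S → ‖t pp i x‖ = 1)
    (hS : haveI : Fact (pp : ℕ).Prime := ⟨pp.2⟩; ∀ w : (thetaIndex X).Fibre (.inr pp), placeOf X pp.1 w ∉ X.S) :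
    (settingDHVolSharp X hlog M archPk archSub Ψ act Mmod region n lat sig split qData tq t htq0 htq1).qRegion
        (labelSucc i) (.inr pp) ⊆
      (settingDHVolSharp X hlog M archPk archSub Ψ act Mmod region n lat sig split qData tq t htq0 htq1).thetaSlotHull
        (labelSucc i) (.inr pp) := by
  haveI : Fact (pp : ℕ).Prime := ⟨pp.2⟩
  refine qRegion_subset_thetaSlotHull_settingDHVolSharp_of_targets X hlog M archPk archSub Ψ act Mmod region n lat sig split qData
    tq t htq0 htq1 (labelSucc i) pp (fun _ => 1) (fun w => ‖t pp i w‖) (fun _ => zero_le_one) (fun _ => norm_nonneg _)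
    (fun x => ⟨LinearEquiv.refl ℚ _, refl_mem_ismDH logv x.1, ?_⟩)
    (fun w => ⟨LinearEquiv.refl ℚ _, refl_mem_ismDH logv w.1, ?_⟩) fun e => ?_
  · simp only [LinearEquiv.refl_apply, LinearEquiv.apply_symm_apply, norm_one]
    exact le_rfl
  · rw [labelIdele_labelSucc]
    simp only [LinearEquiv.refl_apply, LinearEquiv.apply_symm_apply]
    exact le_of_eq rfl
  · rw [Finset.prod_const_one, one_mul, htq1 pp _ (hS _), ht1 pp i _ (hS _)]

/-- **THE TAME MULTI-SLOT WINDOW IN ORDERS** at the packet `(i+1, p)`: `e·⌊(m_Θ−1)/e⌋ + 1 − (i+1)(e−1) ≤ m_q` ⟹ q-region ⊆ SLOT hull — twin of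
abc-iut-w4-d006 / w5-d236's `…thetaHull…_of_tame_orders`. [claim: Mochizuki2012, status: disputed] [cite: DupuyHilado2025, §3.9, §4.9] -/
theorem qRegion_subset_thetaSlotHull_settingDHVolSharp_of_tame_orders (i : Fin (thetaIndex X).lstar) (pp : Nat.Primes)
    (hp2 : 2 < (pp : ℕ)) (e : ℕ) (hep : e ≤ (pp : ℕ) - 2)
    (ϖ : haveI : Fact (pp : ℕ).Prime := ⟨pp.2⟩; ∀ x : (thetaIndex X).Fibre (.inr pp), (kOf X pp.1 x)ˣ)
    (hfib : haveI : Fact (pp : ℕ).Prime := ⟨pp.2⟩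
      ∀ x : (thetaIndex X).Fibre (.inr pp), (placeOf X pp.1 x).asIdeal.ramificationIdx ℤ = e ∧ IsUniformizer (ϖ x))
    (hord : haveI : Fact (pp : ℕ).Prime := ⟨pp.2⟩
      ∀ w : (thetaIndex X).Fibre (.inr pp),
        ‖tq pp w‖ ≤ ‖t pp i w‖ ∨
          ∃ mΘ mq : ℤ, ‖t pp i w‖ = ‖(ϖ w : kOf X pp.1 w)‖ ^ mΘ ∧ ‖tq pp w‖ = ‖(ϖ w : kOf X pp.1 w)‖ ^ mq ∧ 1 ≤ mΘ ∧
            (e : ℤ) * ((mΘ - 1) / e) + 1 - ((i : ℕ) + 1 : ℕ) * ((e : ℤ) - 1) ≤ mq) :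
    (settingDHVolSharp X hlog M archPk archSub Ψ act Mmod region n lat sig split qData tq t htq0 htq1).qRegion
        (labelSucc i) (.inr pp) ⊆
      (settingDHVolSharp X hlog M archPk archSub Ψ act Mmod region n lat sig split qData tq t htq0 htq1).thetaSlotHull
        (labelSucc i) (.inr pp) := by
  haveI hF : Fact (pp : ℕ).Prime := ⟨pp.2⟩
  have hp1 : (1 : ℝ) ≤ (pp : ℕ) := by exact_mod_cast pp.2.one_lt.le
  have hp0 : (0 : ℝ) < (pp : ℕ) := by positivity
  -- the invariants at a place over `p`: `e_K = e`, `‖ϖ_x‖ = p^{-1/e}`, `‖ϖ_x‖^e = p⁻¹`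
  have heK : ∀ x : (thetaIndex X).Fibre (.inr pp), absRamificationIdx (pp : ℕ) (kOf X pp.1 x) = e := fun x =>
    (absRamificationIdx_rescaledCompletion F (pp : ℕ) (placeOf X pp.1 x) (natCast_mem_placeOf X pp.1 x)).trans (hfib x).1
  have he0 : 0 < e := by
    rw [← heK (Classical.arbitrary _)]
    exact absRamificationIdx_pos _ _
  -- donation rate `ρ = p · p^{-1/e}`
  set ρ : ℝ := ((pp : ℕ) : ℝ) * ((pp : ℕ) : ℝ) ^ (-(1 / (e : ℝ))) with hρ
  have hnormϖ : ∀ x : (thetaIndex X).Fibre (.inr pp), ‖(ϖ x : kOf X pp.1 x)‖ = ((pp : ℕ) : ℝ) ^ (-(1 / (e : ℝ))) := by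
    intro x
    rw [norm_eq_rpow_of_isUniformizer (pp : ℕ) (kOf X pp.1 x) (hfib x).2, heK x]
  have hρ1 : 1 ≤ ρ := by
    have h : ((pp : ℕ) : ℝ) ^ (-(1 : ℝ)) ≤ ((pp : ℕ) : ℝ) ^ (-(1 / (e : ℝ))) := by
      refine Real.rpow_le_rpow_of_exponent_le hp1 (neg_le_neg ?_)
      rw [div_le_one (by exact_mod_cast he0)]
      exact_mod_cast he0
    calc (1 : ℝ) = ((pp : ℕ) : ℝ) * ((pp : ℕ) : ℝ) ^ (-(1 : ℝ)) := by
          rw [Real.rpow_neg_one, mul_inv_cancel₀ hp0.ne']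
      _ ≤ ρ := mul_le_mul_of_nonneg_left h hp0.le
  refine qRegion_subset_thetaSlotHull_settingDHVolSharp_of_tame_slots X hlog M archPk archSub Ψ act Mmod region n lat sig split qData
    tq t htq0 htq1 i pp ρ hρ1 (fun x => ⟨hp2, (hfib x).1.le.trans hep, ϖ x, (hfib x).2, le_of_eq ?_⟩) fun w => ?_
  · -- `ρ = ‖p‖⁻¹ · ‖ϖ_x‖`
    rw [hnormϖ x, Padic.norm_p, inv_inv]
  · rcases hord w with h | ⟨mΘ, mq, hΘ, hq, h1, hle⟩
    · exact Or.inl h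
    · right
      set a : ℝ := ‖(ϖ w : kOf X pp.1 w)‖ with ha
      have ha0 : 0 < a := norm_pos_iff.2 (ϖ w).ne_zero
      have ha1 : a < 1 := (hfib w).2.norm_lt_one
      have hae : a ^ e = ((pp : ℕ) : ℝ)⁻¹ := by rw [ha, ← heK w]; exact norm_pow_absRamificationIdx (pp : ℕ) _ (hfib w).2
      have hpnorm : ‖((pp : ℕ) : ℚ_[pp])‖ = a ^ (e : ℤ) := by rw [Padic.norm_p, zpow_natCast, hae]
      have hρa : ρ = a ^ (1 - (e : ℤ)) := by
        rw [zpow_sub₀ ha0.ne', zpow_one, zpow_natCast, hae, div_inv_eq_mul, hρ, ← hnormϖ w, ← ha, mul_comm]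
      -- the `p`-level of `t_Θ`: `k = ⌊(m_Θ − 1)/e⌋`
      set k : ℤ := (mΘ - 1) / e with hk
      have hediv : (e : ℤ) * k ≤ mΘ - 1 := Int.mul_ediv_self_le (by exact_mod_cast he0.ne')
      have hemod : mΘ - 1 < (e : ℤ) * k + e := Int.lt_mul_ediv_self_add (by exact_mod_cast he0)
      have hzle : ∀ A B : ℤ, a ^ A ≤ a ^ B ↔ B ≤ A := fun A B => zpow_le_zpow_iff_right_of_lt_one₀ ha0 ha1
      have hzlt : ∀ A B : ℤ, a ^ A < a ^ B ↔ B < A := fun A B => zpow_lt_zpow_iff_right_of_lt_one₀ ha0 ha1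
      refine ⟨ϖ w, k, (hfib w).2, ?_, ?_, ?_⟩
      · -- `‖p‖·(‖p‖^k·‖ϖ‖) < ‖t_Θ‖`
        rw [hΘ, hpnorm, ← zpow_mul, ← ha, ← zpow_add_one₀ ha0.ne', ← zpow_add₀ ha0.ne', hzlt]
        linarith
      · -- `‖t_Θ‖ ≤ ‖p‖^k·‖ϖ‖`
        rw [hΘ, hpnorm, ← zpow_mul, ← ha, ← zpow_add_one₀ ha0.ne', hzle]
        linarith
      · -- `‖t_q‖ ≤ ρ^{i+1}·(‖p‖^k·‖ϖ‖)`
        rw [hq, hpnorm, hρa, ← zpow_mul, ← ha, ← zpow_add_one₀ ha0.ne', ← zpow_natCast, ← zpow_mul,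
          ← zpow_add₀ ha0.ne', hzle]
        push_cast at hle ⊢
        linarith

/-- **THE SLOT LICENCE AT `settingDHVolSharp` IN ORDERS (uniformly ramified tame fibres)** — twin of `licence_settingDHVolSharp_of_tame_orders` with the
conclusion `Cor312.Setting.SlotLicence`. [claim: Mochizuki2012, status: disputed] [cite: DupuyHilado2025, §3.9, §4.9] -/
theorem slotLicence_settingDHVolSharp_of_tame_orders
    (ht1 : ∀ (pp : Nat.Primes) (i : Fin X.lstar) (x : (thetaIndex X).Fibre (.inr pp)),
      haveI : Fact (pp : ℕ).Prime := ⟨pp.2⟩; placeOf X pp.1 x ∉ X.S → ‖t pp i x‖ = 1)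
    (e : Nat.Primes → ℕ)
    (ϖ : ∀ (pp : Nat.Primes) (x : (thetaIndex X).Fibre (.inr pp)), haveI : Fact (pp : ℕ).Prime := ⟨pp.2⟩; (kOf X pp.1 x)ˣ)
    (hfib : ∀ (pp : Nat.Primes) (x : (thetaIndex X).Fibre (.inr pp)),
      haveI : Fact (pp : ℕ).Prime := ⟨pp.2⟩
      (∃ w : (thetaIndex X).Fibre (.inr pp), placeOf X pp.1 w ∈ X.S) →
        2 < (pp : ℕ) ∧ e pp ≤ (pp : ℕ) - 2 ∧ (placeOf X pp.1 x).asIdeal.ramificationIdx ℤ = e pp ∧ IsUniformizer (ϖ pp x))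
    (hord : ∀ (pp : Nat.Primes) (i : Fin (thetaIndex X).lstar) (w : (thetaIndex X).Fibre (.inr pp)),
      haveI : Fact (pp : ℕ).Prime := ⟨pp.2⟩
      placeOf X pp.1 w ∈ X.S →
        ‖tq pp w‖ ≤ ‖t pp i w‖ ∨
          ∃ mΘ mq : ℤ, ‖t pp i w‖ = ‖(ϖ pp w : kOf X pp.1 w)‖ ^ mΘ ∧ ‖tq pp w‖ = ‖(ϖ pp w : kOf X pp.1 w)‖ ^ mq ∧ 1 ≤ mΘ ∧
            (e pp : ℤ) * ((mΘ - 1) / e pp) + 1 - ((i : ℕ) + 1 : ℕ) * ((e pp : ℤ) - 1) ≤ mq) :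
    (settingDHVolSharp X hlog M archPk archSub Ψ act Mmod region n lat sig split qData tq t htq0 htq1).SlotLicence := by
  intro i vQ
  cases vQ with
  | inl u =>
    exact qRegion_subset_thetaSlotHull_settingDHVolSharp_inl X hlog M archPk archSub Ψ act Mmod region n lat sig split qData tq t htq0
      htq1 (labelSucc i) u
  | inr pp =>
    haveI : Fact (pp : ℕ).Prime := ⟨pp.2⟩
    by_cases hS : ∃ w : (thetaIndex X).Fibre (.inr pp), placeOf X pp.1 w ∈ X.S
    · obtain ⟨hp2, hep, -⟩ := hfib pp (Classical.arbitrary _) hS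
      refine qRegion_subset_thetaSlotHull_settingDHVolSharp_of_tame_orders X hlog M archPk archSub Ψ act Mmod region n lat sig split
        qData tq t htq0 htq1 i pp hp2 (e pp) hep (ϖ pp) (fun x => ⟨(hfib pp x hS).2.2.1, (hfib pp x hS).2.2.2⟩) fun w => ?_
      by_cases hw : placeOf X pp.1 w ∈ X.S
      · exact hord pp i w hw
      · exact Or.inl (by rw [ht1 pp i w hw, htq1 pp w hw])
    · exact qRegion_subset_thetaSlotHull_settingDHVolSharp_of_forall_not_mem X hlog M archPk archSub Ψ act Mmod region n lat sig split
        qData tq t htq0 htq1 i pp ht1 fun w hw => hS ⟨w, hw⟩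

/-- **The same at `settingPrVolSharp`** (`slotLicence_settingPrVolSharp_iff_settingDHVolSharp`). [claim: Mochizuki2012, status: disputed] -/
theorem slotLicence_settingPrVolSharp_of_tame_orders
    (ht1 : ∀ (pp : Nat.Primes) (i : Fin X.lstar) (x : (thetaIndex X).Fibre (.inr pp)),
      haveI : Fact (pp : ℕ).Prime := ⟨pp.2⟩; placeOf X pp.1 x ∉ X.S → ‖t pp i x‖ = 1)
    (e : Nat.Primes → ℕ)
    (ϖ : ∀ (pp : Nat.Primes) (x : (thetaIndex X).Fibre (.inr pp)), haveI : Fact (pp : ℕ).Prime := ⟨pp.2⟩; (kOf X pp.1 x)ˣ)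
    (hfib : ∀ (pp : Nat.Primes) (x : (thetaIndex X).Fibre (.inr pp)),
      haveI : Fact (pp : ℕ).Prime := ⟨pp.2⟩
      (∃ w : (thetaIndex X).Fibre (.inr pp), placeOf X pp.1 w ∈ X.S) →
        2 < (pp : ℕ) ∧ e pp ≤ (pp : ℕ) - 2 ∧ (placeOf X pp.1 x).asIdeal.ramificationIdx ℤ = e pp ∧ IsUniformizer (ϖ pp x))
    (hord : ∀ (pp : Nat.Primes) (i : Fin (thetaIndex X).lstar) (w : (thetaIndex X).Fibre (.inr pp)),
      haveI : Fact (pp : ℕ).Prime := ⟨pp.2⟩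
      placeOf X pp.1 w ∈ X.S →
        ‖tq pp w‖ ≤ ‖t pp i w‖ ∨
          ∃ mΘ mq : ℤ, ‖t pp i w‖ = ‖(ϖ pp w : kOf X pp.1 w)‖ ^ mΘ ∧ ‖tq pp w‖ = ‖(ϖ pp w : kOf X pp.1 w)‖ ^ mq ∧ 1 ≤ mΘ ∧
            (e pp : ℤ) * ((mΘ - 1) / e pp) + 1 - ((i : ℕ) + 1 : ℕ) * ((e pp : ℤ) - 1) ≤ mq) :
    (settingPrVolSharp X hlog M archPk archSub Ψ act Mmod region n lat sig split qData tq t htq0 htq1).SlotLicence := by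
  rw [slotLicence_settingPrVolSharp_iff_settingDHVolSharp]
  exact slotLicence_settingDHVolSharp_of_tame_orders X hlog M archPk archSub Ψ act Mmod region n lat sig split qData tq t htq0 htq1 ht1 e
    ϖ hfib hord

end Summit.ABC.IUTFork.Thm311.Real

end
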